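import Summits.AtomisticToContinuum.BoseEinsteinCondensation.Theorems.BECHeatBathGapSquareSummableInfluenceMayersRepresentation
import Mathlib.Analysis.InnerProductSpace.Projection.Basic
import HarnessLib

/-!
# Route `BECHeatBathGap`, crux `SquareSummableInfluence` (stmt-AtomisticToContinuum-14368), line `registered`:
# Bessel on one fibre and Tonelli with the bath outermost (tools for the intrinsic Mayers bound)

Supports (does not close) stmt-AtomisticToContinuum-14368 (lead c6). Tools for the sequel `…MayersAlignment.lean`
(occupation ≥ intrinsic alignment functional − one bath particle's influence):

* `lintegral_sq_le_sq_div_add_leastSquares` — Bessel/Pythagoras on one fibre of `L²(μ; ℂ)`: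
  `∫|F|² ≤ |∫conj θ·F|²/∫|θ|² + ∫|F − c⋆θ|²`, `c⋆` the least-squares coefficient (Mathlib's
  `Submodule.norm_sq_eq_add_norm_sq_starProjection` for the line `ℂ θ`, translated to `ℝ≥0∞` integrals);
* `update_zero_eq_vecCons_vecTail` — `Z with slot 0 ↦ a = a :: tail Z`;
* `setLIntegral_boxN_box_vecCons` — `∫_{Λ^n} ∫_Λ G(y :: X) dy dX = ∫_{Λ^{n+1}} G` (bath outermost; the landed
  `setLIntegral_box_boxN_vecCons` has the inserted particle outermost).

`[folklore]`.
-/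

noncomputable section

open MeasureTheory Filter Function
open scoped ENNReal NNReal Topology ComplexConjugate InnerProductSpace

namespace Summit.AtomisticToContinuum.BoseEinsteinCondensation.Theorems.SquareSummableInfluence

open Literature.MathematicalPhysics.QuantumManyBody.BoseGas

/-! ### Bessel on one fibre -/

/-- **Bessel on one fibre.** In `L²(μ; ℂ)`, for square-integrable `F, θ`:
`∫|F|² ≤ |∫ conj θ · F|² / ∫|θ|² + ∫ |F − c⋆ θ|²` with the least-squares coefficient `c⋆ = (∫ conj θ · F)/∫|θ|²`
(Pythagoras for the projection onto `ℂ θ`, an equality when `0 < ∫|θ|² < ∞`; for `∫|θ|² = 0` the right-hand side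
is `≥ ∫|F|²` trivially). [folklore] -/
theorem lintegral_sq_le_sq_div_add_leastSquares {α : Type*} [MeasurableSpace α] {μ : Measure α}
    {F θ : α → ℂ} (hF : AEStronglyMeasurable F μ) (hθ : AEStronglyMeasurable θ μ)
    (hF2 : ∫⁻ x, (‖F x‖₊ : ℝ≥0∞) ^ 2 ∂μ ≠ ⊤) (hθ2 : ∫⁻ x, (‖θ x‖₊ : ℝ≥0∞) ^ 2 ∂μ ≠ ⊤) :
    ∫⁻ x, (‖F x‖₊ : ℝ≥0∞) ^ 2 ∂μ ≤
      (‖∫ x, conj (θ x) * F x ∂μ‖₊ : ℝ≥0∞) ^ 2 / (∫⁻ x, (‖θ x‖₊ : ℝ≥0∞) ^ 2 ∂μ) +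
        ∫⁻ x, (‖F x - (∫ y, conj (θ y) * F y ∂μ) / (((∫⁻ y, (‖θ y‖₊ : ℝ≥0∞) ^ 2 ∂μ).toReal : ℝ) : ℂ) *
          θ x‖₊ : ℝ≥0∞) ^ 2 ∂μ := by
  set m : ℝ≥0∞ := ∫⁻ x, (‖θ x‖₊ : ℝ≥0∞) ^ 2 ∂μ with hm
  set o : ℂ := ∫ x, conj (θ x) * F x ∂μ with ho
  rcases eq_or_ne m 0 with hm0 | hm0
  · -- `θ = 0` a.e.: the coefficient is `o / 0 = 0` and the defect is `∫|F|²`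
    have h0 : (((m.toReal : ℝ)) : ℂ) = 0 := by rw [hm0]; simp
    rw [h0, div_zero]
    simp only [zero_mul, sub_zero]
    exact le_add_self
  have hFL : MemLp F 2 μ := memLp_two_of_lintegral_ne_top hF hF2
  have hθL : MemLp θ 2 μ := memLp_two_of_lintegral_ne_top hθ hθ2
  set F' := hFL.toLp F with hF'
  set Θ' := hθL.toLp θ with hΘ'
  set cs : ℂ := o / (((m.toReal : ℝ)) : ℂ) with hcs
  have hmpos : 0 < m.toReal := ENNReal.toReal_pos hm0 hθ2
  -- the projection of `F'` onto the line `ℂ Θ'` is `cs • Θ'`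
  have hproj : (ℂ ∙ Θ').starProjection F' = cs • Θ' := by
    rw [Submodule.starProjection_singleton ℂ F', inner_toLp_eq_integral_conj_mul hFL hθL,
      norm_toLp_sq_eq_toReal_lintegral hθL]
    rfl
  -- Pythagoras
  have hpy := Submodule.norm_sq_eq_add_norm_sq_starProjection F' (ℂ ∙ Θ')
  rw [Submodule.starProjection_orthogonal_val, hproj] at hpy
  -- translate the three norms
  have hD : MemLp (F - cs • θ) 2 μ := hFL.sub (hθL.const_smul cs)
  have h1 : ‖F'‖ ^ 2 = (∫⁻ x, (‖F x‖₊ : ℝ≥0∞) ^ 2 ∂μ).toReal := norm_toLp_sq_eq_toReal_lintegral hFL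
  have h2 : ‖cs • Θ'‖ ^ 2 = ‖o‖ ^ 2 / m.toReal := by
    rw [norm_smul, mul_pow, norm_toLp_sq_eq_toReal_lintegral hθL, hcs, norm_div, Complex.norm_real,
      Real.norm_of_nonneg hmpos.le, div_pow]
    rw [← hm]
    field_simp
  have h3 : ‖F' - cs • Θ'‖ ^ 2 = (∫⁻ x, (‖F x - cs * θ x‖₊ : ℝ≥0∞) ^ 2 ∂μ).toReal := by
    rw [hF', hΘ', ← MemLp.toLp_const_smul, ← MemLp.toLp_sub, norm_toLp_sq_eq_toReal_lintegral hD]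
    simp only [Pi.sub_apply, Pi.smul_apply, smul_eq_mul]
  rw [h1, h2, h3] at hpy
  have hfin3 : ∫⁻ x, (‖F x - cs * θ x‖₊ : ℝ≥0∞) ^ 2 ∂μ ≠ ⊤ := by
    have h := lintegral_rpow_enorm_lt_top_of_eLpNorm_lt_top two_ne_zero ENNReal.ofNat_ne_top hD.eLpNorm_lt_top
    rw [ENNReal.toReal_ofNat] at h
    simp_rw [enorm_eq_nnnorm, ENNReal.rpow_two, Pi.sub_apply, Pi.smul_apply, smul_eq_mul] at h
    exact h.ne
  -- back to `ℝ≥0∞`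
  have hdiv : (‖o‖₊ : ℝ≥0∞) ^ 2 / m = ENNReal.ofReal (‖o‖ ^ 2 / m.toReal) := by
    rw [ENNReal.ofReal_div_of_pos hmpos, ← coe_nnnorm_sq_eq_ofReal, ENNReal.ofReal_toReal hθ2]
  calc ∫⁻ x, (‖F x‖₊ : ℝ≥0∞) ^ 2 ∂μ = ENNReal.ofReal ((∫⁻ x, (‖F x‖₊ : ℝ≥0∞) ^ 2 ∂μ).toReal) :=
        (ENNReal.ofReal_toReal hF2).symm
    _ = ENNReal.ofReal (‖o‖ ^ 2 / m.toReal + (∫⁻ x, (‖F x - cs * θ x‖₊ : ℝ≥0∞) ^ 2 ∂μ).toReal) := by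
        rw [hpy]
    _ = (‖o‖₊ : ℝ≥0∞) ^ 2 / m + ∫⁻ x, (‖F x - cs * θ x‖₊ : ℝ≥0∞) ^ 2 ∂μ := by
        rw [ENNReal.ofReal_add (by positivity) ENNReal.toReal_nonneg, hdiv, ENNReal.ofReal_toReal hfin3]
    _ ≤ _ := le_rfl

/-! ### Bookkeeping for the inserted-particle fibre -/

/-- `Z with slot 0 ↦ a = a :: tail Z`. [folklore] -/
theorem update_zero_eq_vecCons_vecTail {N : ℕ} (Z : Config (N + 1)) (a : Space) :
    update Z 0 a = Matrix.vecCons a (Matrix.vecTail Z) := by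
  conv_lhs => rw [← Fin.cons_self_tail Z]
  rw [Fin.update_cons_zero]
  rfl

/-- **Tonelli restricted to the boxes, bath outermost**: `∫_{Λ^n} (∫_{Λ} G(y :: X) dy) dX = ∫_{Λ^{n+1}} G`.
[folklore] -/
theorem setLIntegral_boxN_box_vecCons :
    ∀ {n : ℕ} (L : ℝ) {G : Config (n + 1) → ℝ≥0∞}, Measurable G →
      ∫⁻ X in boxN n L, ∫⁻ y in box L, G (Matrix.vecCons y X) = ∫⁻ Z in boxN (n + 1) L, G Z := by
  intro n L G hG
  rw [← setLIntegral_box_boxN_vecCons L hG]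
  have h : AEMeasurable (uncurry fun (y : Space) (X : Config n) => G (Matrix.vecCons y X))
      (((volume : Measure Space).restrict (box L)).prod ((volume : Measure (Config n)).restrict (boxN n L))) :=
    (hG.comp measurable_vecCons).aemeasurable
  exact (lintegral_lintegral_swap h).symm

end Summit.AtomisticToContinuum.BoseEinsteinCondensation.Theorems.SquareSummableInfluence

end
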